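import Literature.MathematicalPhysics.KineticTheory.FluctuationSpaceStone
import Literature.MathematicalPhysics.KineticTheory.HardSphereGasFluctuations
import Literature.Analysis.FluidPDE.InfiniteHardSphereKoopman
import Summits.AtomisticToContinuum.HydrodynamicLimit.Theorems.MourreKoopmanChargesStressStrongMixingObservableSpan
import HarnessLib

/-!
# `OneBodyCompleteness` · line `registered`, stub `stub_strongContinuityOfGenerators`: CLOSED
# (strong continuity of the Koopman group from dynamical continuity of the generators)

Support file for the crux item stmt-AtomisticToContinuum-9583 (`OneBodyCompleteness`, route
`MourreKoopmanCharges` of `AtomisticToContinuum/HydrodynamicLimit`), line `registered`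
(`Cruxes/OneBodyCompleteness/Lines/birth.lean`, skeleton v6), closing the registered stub
`stub_strongContinuityOfGenerators` VERBATIM:

  `∀ ε F Φ S, (∀ t, F.flow t = Φ.flow t) → F.localObs = flowShiftSpan Φ S →`
  `(∀ b ∈ S, ContinuousAt (t ↦ ∫ Cov_{F.μ}(b, (b ∘ Φ_t) ∘ τ_x) dx) 0) →`
  `∀ ψ : ℋ_F, Continuous (t ↦ U_t ψ)`:

for hard-sphere fluctuation data `F` whose flow is (pointwise) the flow of `Φ` and whose local
observables are the flow–shift span of a generating set `S`, continuity at `t = 0` of the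
space-integrated autocorrelation of each GENERATOR `b ∈ S` already forces strong continuity of the
whole Koopman group `U_t = F.koopman t` on Spohn's fluctuation space `ℋ_F`.

## Proof (pure Hilbert space + the structure of the span; Doyon 2022 Thm 4.11 (III), Reed–Simon Thm VIII.7)

* §1 (any `FluctuationDynamics D`). The continuity set `C = {ψ ∈ ℋ | t ↦ U_t ψ continuous}` is a linear
  subspace (linearity of `U_t`), is invariant under every `U_s` (`U_t U_s = U_s U_t`), and is CLOSED
  (`‖U_t ψ - U_t ψ'‖ = ‖ψ - ψ'‖`: an `ε/3` argument, `continuous_koopman_of_mem_closure`); continuity of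
  an orbit at `t = 0` upgrades to continuity everywhere by the group law `U_t = U_{t₀} U_{t - t₀}`
  (`continuous_koopman_of_tendsto`); for a local observable `a` with `t ↦ ⟨⟨a, a ∘ φ_t⟩⟩` continuous at
  `0`, `‖U_t[a] - [a]‖² = 2(⟨⟨a,a⟩⟩ - ⟨⟨a, a ∘ φ_t⟩⟩) → 0` (`FluctuationDynamics.tendsto_koopman_fluct`,
  `φ_0 = id` a.e.), so `[a] ∈ C` (`continuous_koopman_fluct_of_continuousAt_form`); and by density of the
  classes (`FluctuationStructure.dense_range_fluct`) `C = ℋ` as soon as `[a] ∈ C` for every `a ∈ 𝒱`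
  (`isStronglyContinuous_of_continuous_koopman_fluct`).
* §2 (the hard-sphere datum). For a generator `b ∈ S ⊆ 𝒱` the hypothesis is literally
  `ContinuousAt (t ↦ ⟨⟨b, b ∘ φ_t⟩⟩) 0` (`form_def`, `F.flow = Φ.flow`), so `[b] ∈ C`; an ORBIT observable
  `o = b ∘ Φ_s ∘ τ_y` has class `[o] = [(b ∘ φ_s) ∘ τ_y] = [b ∘ φ_s] = U_s [b]` (`fluct_comp_shift`: the
  translations act trivially on `ℋ`; `koopman_fluct`), hence `[o] ∈ C`, and so `[f'] ∈ C` for every `f'`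
  in the real span of the orbit observables (`fluct_add`, `fluct_smul`); every `f ∈ 𝒱 = flowShiftSpan Φ S`
  is `F.μ`-a.e. such an `f'` (the sibling crux's `exists_ae_eq_span_orbit_of_mem_flowShiftSpan`, fed with
  the FIELDS of `F` — stationarity, `φ_0 = id`, group law, shift covariance, all a.e. — transported along
  `F.flow = Φ.flow`), and `[f] = [f']` (`fluct_congr_ae`). §1 concludes.

References: B. Doyon, *Hydrodynamic projections and the emergence of linearised Euler equations in
one-dimensional isolated systems*, CMP 391 (2022), §4.3 Thm 4.11 (III), Remark 4.7; M. Reed, B. Simon,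
*Methods of Modern Mathematical Physics I* (1972), §VIII.4 Thm VIII.7 (b); H. Spohn, *Large Scale
Dynamics of Interacting Particles* (1991), Part I §7.1, Condition 2.1.
-/

noncomputable section

namespace Summit.AtomisticToContinuum.HydrodynamicLimit.Theorems.MourreKoopmanChargesOneBodyCompleteness

open MeasureTheory ProbabilityTheory Filter Topology
open scoped InnerProductSpace
open Literature.MathematicalPhysics.KineticTheory Literature.Analysis.FluidPDE
open Summit.AtomisticToContinuum.HydrodynamicLimit.Theorems.MourreKoopmanChargesStressStrongMixing
  (exists_ae_eq_span_orbit_of_mem_flowShiftSpan)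

/-! ### §1. The continuity subspace of the Koopman group of a `FluctuationDynamics` -/

section General

variable {G Ω : Type*} [AddCommGroup G] [MeasurableSpace G] [MeasurableSpace Ω]
  {ν : Measure G} {T : ShiftAction G Ω} (D : FluctuationDynamics ν T)
  [MeasurableNeg G] [ν.IsNegInvariant]

/-- **Continuity at `0` upgrades to continuity everywhere** along the Koopman group: if
`U_t ψ → ψ` as `t → 0` then `t ↦ U_t ψ` is continuous (group law `U_t = U_{t₀} U_{t-t₀}` and continuity
of the isometry `U_{t₀}`; Reed–Simon Thm VIII.7 (b)). [cite: ReedSimon1972, Vol. I §VIII.4 Thm VIII.7] -/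
theorem continuous_koopman_of_tendsto {ψ : D.FluctuationSpace}
    (h : Tendsto (fun t : ℝ => D.koopman t ψ) (𝓝 0) (𝓝 ψ)) :
    Continuous fun t : ℝ => D.koopman t ψ := by
  rw [continuous_iff_continuousAt]
  intro t₀
  have e : (fun t : ℝ => D.koopman t ψ) = fun t => D.koopman t₀ (D.koopman (t - t₀) ψ) := by
    funext t
    rw [← D.koopman_add_apply, add_sub_cancel]
  have h3 : Tendsto (fun t : ℝ => t - t₀) (𝓝 t₀) (𝓝 0) := by
    simpa using ((continuous_sub_right t₀).tendsto t₀)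
  have h4 := ((D.koopman t₀).continuous.tendsto ψ).comp (h.comp h3)
  rw [ContinuousAt, e]
  simpa [Function.comp_def] using h4

/-- The zero vector has a continuous (constant) orbit. [folklore] -/
theorem continuous_koopman_zero : Continuous fun t : ℝ => D.koopman t (0 : D.FluctuationSpace) := by
  simp only [map_zero]
  exact continuous_const

/-- The continuity set of the Koopman group is stable under addition (linearity of `U_t`). [folklore] -/
theorem continuous_koopman_add {ψ φ : D.FluctuationSpace} (hψ : Continuous fun t : ℝ => D.koopman t ψ)
    (hφ : Continuous fun t : ℝ => D.koopman t φ) : Continuous fun t : ℝ => D.koopman t (ψ + φ) := by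
  simp only [map_add]
  exact hψ.add hφ

/-- The continuity set of the Koopman group is stable under scalars (linearity of `U_t`). [folklore] -/
theorem continuous_koopman_smul (c : ℝ) {ψ : D.FluctuationSpace}
    (hψ : Continuous fun t : ℝ => D.koopman t ψ) : Continuous fun t : ℝ => D.koopman t (c • ψ) := by
  simp only [map_smul]
  exact hψ.const_smul c

/-- The continuity set of the Koopman group is invariant under every `U_s` (`U_t U_s = U_s U_t` and
`U_s` is continuous). [folklore] -/
theorem continuous_koopman_koopman (s : ℝ) {ψ : D.FluctuationSpace}
    (hψ : Continuous fun t : ℝ => D.koopman t ψ) :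
    Continuous fun t : ℝ => D.koopman t (D.koopman s ψ) := by
  have e : (fun t : ℝ => D.koopman t (D.koopman s ψ)) = fun t => D.koopman s (D.koopman t ψ) := by
    funext t
    exact D.koopman_comm_apply t s ψ
  rw [e]
  exact (D.koopman s).continuous.comp hψ

/-- **The continuity set of the Koopman group is closed**: a limit of vectors with continuous orbits
has a continuous orbit, since `‖U_t ψ - U_t φ‖ = ‖ψ - φ‖` uniformly in `t` (uniform limits of continuous
maps; Reed–Simon Thm VIII.7 (b)). [cite: ReedSimon1972, Vol. I §VIII.4 Thm VIII.7] -/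
theorem continuous_koopman_of_mem_closure {ψ : D.FluctuationSpace}
    (hψ : ψ ∈ closure {φ : D.FluctuationSpace | Continuous fun t : ℝ => D.koopman t φ}) :
    Continuous fun t : ℝ => D.koopman t ψ := by
  rw [continuous_iff_continuousAt]
  intro t₀
  rw [ContinuousAt, Metric.tendsto_nhds]
  intro ε hε
  obtain ⟨φ, hφC, hφ⟩ := Metric.mem_closure_iff.1 hψ (ε / 3) (by positivity)
  have hc : Continuous fun t : ℝ => D.koopman t φ := hφC
  have h2 := Metric.tendsto_nhds.1 (hc.tendsto t₀) (ε / 3) (by positivity)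
  filter_upwards [h2] with t ht
  calc dist (D.koopman t ψ) (D.koopman t₀ ψ)
      ≤ dist (D.koopman t ψ) (D.koopman t φ) + dist (D.koopman t φ) (D.koopman t₀ φ) +
          dist (D.koopman t₀ φ) (D.koopman t₀ ψ) := dist_triangle4 _ _ _ _
    _ = dist ψ φ + dist (D.koopman t φ) (D.koopman t₀ φ) + dist ψ φ := by
        rw [(D.koopman t).dist_map, (D.koopman t₀).dist_map, dist_comm φ ψ]
    _ < ε / 3 + ε / 3 + ε / 3 := by gcongr
    _ = ε := by ring

/-- **A local observable with continuous autocorrelation has a continuous orbit**: if `a ∈ 𝒱` and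
`t ↦ ⟨⟨a, a ∘ φ_t⟩⟩` is continuous at `0`, then `t ↦ U_t [a]` is continuous (`φ_0 = id` a.e. identifies the
value at `0`; `‖U_t [a] - [a]‖² = 2(⟨⟨a,a⟩⟩ - ⟨⟨a, a ∘ φ_t⟩⟩)`; then the group law; Doyon 2022 Thm 4.11 (III)).
[cite: Doyon2022, §4.3 Thm 4.11] -/
theorem continuous_koopman_fluct_of_continuousAt_form {a : Ω → ℝ} (ha : a ∈ D.localObs)
    (h : ContinuousAt (fun t : ℝ => D.form a (a ∘ D.flow t)) 0) :
    Continuous fun t : ℝ => D.koopman t (D.fluct a) := by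
  have h0 : D.form a (a ∘ D.flow 0) = D.form a a := by
    have e := FluctuationStructure.form_congr_ae (F := D.toFluctuationStructure)
      (EventuallyEq.rfl (f := a)) (D.flow_zero.fun_comp a)
    simpa [Function.comp_def] using e
  have h1 : Tendsto (fun t : ℝ => D.form a (a ∘ D.flow t)) (𝓝 0) (𝓝 (D.form a a)) := by
    simpa [ContinuousAt, h0] using h
  exact continuous_koopman_of_tendsto D (D.tendsto_koopman_fluct ha h1)

/-- **Strong continuity from the classes**: if `t ↦ U_t [a]` is continuous for every local observable
`a ∈ 𝒱`, then `t ↦ U_t ψ` is continuous for every `ψ ∈ ℋ` (the classes are dense and the continuity set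
is closed; Reed–Simon Thm VIII.7 (b)). [cite: ReedSimon1972, Vol. I §VIII.4 Thm VIII.7] -/
theorem isStronglyContinuous_of_continuous_koopman_fluct
    (h : ∀ ⦃a : Ω → ℝ⦄, a ∈ D.localObs → Continuous fun t : ℝ => D.koopman t (D.fluct a)) :
    D.IsStronglyContinuous := by
  intro ψ
  apply continuous_koopman_of_mem_closure D
  have hsub : (Set.range fun a : D.localObs => D.fluct (a : Ω → ℝ)) ⊆
      {φ : D.FluctuationSpace | Continuous fun t : ℝ => D.koopman t φ} := by
    rintro _ ⟨a, rfl⟩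
    exact h a.2
  have hψ : ψ ∈ closure (Set.range fun a : D.localObs => D.fluct (a : Ω → ℝ)) := by
    rw [FluctuationStructure.dense_range_fluct.closure_eq]
    exact Set.mem_univ ψ
  exact closure_mono hsub hψ

end General

/-! ### §2. The registered stub -/

/-- **Registered stub `stub_strongContinuityOfGenerators` (CLOSED) — strong continuity from the
generators.** For hard-sphere fluctuation data `F` whose flow is (pointwise) the flow of `Φ` and whose
local observables are the flow–shift span of a generating set `S`, continuity at `t = 0` of the
space-integrated autocorrelation `t ↦ ∫ Cov(b, (b ∘ Φ_t) ∘ τ_x) dx` of each GENERATOR `b ∈ S` already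
forces strong continuity of the whole Koopman group: `‖U_t[b] - [b]‖² = 2(⟨⟨b,b⟩⟩ - ⟨⟨b, b∘Φ_t⟩⟩)` gives
continuity of `t ↦ U_t[b]` (isometries + group law), the continuity set is a closed invariant subspace,
and the classes of the span are spanned — up to null observables — by the orbit classes
`[b ∘ Φ_s ∘ τ_y] = U_s[b]`, which are dense. [cite: Doyon2022, §4.3 Thm 4.11] -/
theorem stub_strongContinuityOfGenerators :
    ∀ (ε : ℝ) (F : HardSphereFluctuationData ε) (Φ : InfiniteHardSphereFlow (Fin 3) ε)
      (S : Set (MarkedConfig → ℝ)), (∀ t : ℝ, F.flow t = Φ.flow t) → F.localObs = flowShiftSpan Φ S →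
      (∀ b ∈ S, ContinuousAt (fun t : ℝ => ∫ x : V3, cov[b, (b ∘ Φ.flow t) ∘ spatialShift x; F.μ]) 0) →
      ∀ ψ : HardSphereFluctuationSpace F, Continuous fun t : ℝ => F.koopman t ψ := by
  intro ε F Φ S hflow hloc hcont
  -- the a.e. flow axioms of `F`, transported along `F.flow = Φ.flow`
  have hpres : ∀ t : ℝ, MeasurePreserving (Φ.flow t) F.μ F.μ := fun t =>
    hflow t ▸ F.measurePreserving_flow t
  have hzero : Φ.flow 0 =ᵐ[F.μ] id := hflow 0 ▸ F.flow_zero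
  have hadd : ∀ s t : ℝ, Φ.flow (s + t) =ᵐ[F.μ] Φ.flow s ∘ Φ.flow t := by
    intro s t
    have h := F.flow_add s t
    simp only [hflow] at h
    exact h
  have hcomm : ∀ (t : ℝ) (x : V3), Φ.flow t ∘ spatialShift x =ᵐ[F.μ] spatialShift x ∘ Φ.flow t := by
    intro t x
    have h := F.flow_comm_shift t x
    simp only [hflow] at h
    exact h
  -- generators and orbit observables are local observables
  have hSmem : ∀ b ∈ S, b ∈ F.localObs := fun b hb => by
    rw [hloc]
    exact subset_flowShiftSpan hb
  set O : Set (MarkedConfig → ℝ) :=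
    {o | ∃ a ∈ S, ∃ (t : ℝ) (y : V3), o = a ∘ Φ.flow t ∘ spatialShift y} with hO
  have hOmem : O ⊆ F.localObs := by
    rintro _ ⟨b, hb, s, y, rfl⟩
    rw [hloc]
    exact comp_shift_mem_flowShiftSpan y (comp_flow_mem_flowShiftSpan s (subset_flowShiftSpan hb))
  have hspanO : Submodule.span ℝ O ≤ F.localObs := Submodule.span_le.2 hOmem
  -- (1) generators have continuous orbits
  have hgen : ∀ b ∈ S, Continuous fun t : ℝ => F.koopman t (F.fluct b) := by
    intro b hb
    refine continuous_koopman_fluct_of_continuousAt_form F.toFluctuationDynamics (hSmem b hb) ?_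
    have e : (fun t : ℝ => F.form b (b ∘ F.flow t)) =
        fun t : ℝ => ∫ x : V3, cov[b, (b ∘ Φ.flow t) ∘ spatialShift x; F.μ] := by
      funext t
      rw [FluctuationStructure.form_def, hflow t]
    rw [e]
    exact hcont b hb
  -- (2) orbit observables: `[b ∘ Φ_s ∘ τ_y] = U_s [b]`
  have horb : ∀ o ∈ O, Continuous fun t : ℝ => F.koopman t (F.fluct o) := by
    rintro _ ⟨b, hb, s, y, rfl⟩
    have hbs : b ∘ F.flow s ∈ F.localObs := F.comp_flow_mem s (hSmem b hb)
    have e : F.fluct (b ∘ Φ.flow s ∘ spatialShift y) = F.koopman s (F.fluct b) := by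
      rw [F.koopman_fluct s (hSmem b hb), ← hflow s]
      exact FluctuationStructure.fluct_comp_shift y hbs
    rw [e]
    exact continuous_koopman_koopman F.toFluctuationDynamics s (hgen b hb)
  -- (3) the real span of the orbit observables
  have hspan : ∀ g ∈ Submodule.span ℝ O, Continuous fun t : ℝ => F.koopman t (F.fluct g) := by
    intro g hg
    induction hg using Submodule.span_induction with
    | mem o ho => exact horb o ho
    | zero =>
      rw [FluctuationStructure.fluct_zero]
      exact continuous_koopman_zero F.toFluctuationDynamics
    | add g₁ g₂ hg₁ hg₂ ih₁ ih₂ =>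
      rw [FluctuationStructure.fluct_add (hspanO hg₁) (hspanO hg₂)]
      exact continuous_koopman_add F.toFluctuationDynamics ih₁ ih₂
    | smul c g hg ih =>
      rw [FluctuationStructure.fluct_smul c (hspanO hg)]
      exact continuous_koopman_smul F.toFluctuationDynamics c ih
  -- (4) every local observable is a.e. such a combination; (5) density
  refine isStronglyContinuous_of_continuous_koopman_fluct F.toFluctuationDynamics fun f hf => ?_
  have hf' : f ∈ flowShiftSpan Φ S := by
    rw [← hloc]
    exact hf
  obtain ⟨g, hg, hfg⟩ := exists_ae_eq_span_orbit_of_mem_flowShiftSpan Φ F.μ hpres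
    F.measurePreserving_shift hzero hadd hcomm hf'
  have efg : F.fluct f = F.fluct g := FluctuationStructure.fluct_congr_ae hf (hspanO hg) hfg
  rw [efg]
  exact hspan g hg

end Summit.AtomisticToContinuum.HydrodynamicLimit.Theorems.MourreKoopmanChargesOneBodyCompleteness

end
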